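import Summits.RiemannHypothesis.RiemannHypothesis.Theorems.Splittings.TruncatedFourierSynthesisL2

/-!
# Near-lattice synthesis of `2 sinh(κu)` on `[−1,1]` by exponentials with frequencies near a lattice and small `ℓ²` amplitude norm

Splittings — x-wuc (xiv-d L2).  ζ-FREE.  ONE theorem, `nearLatticeSynthesis` (statement in its docstring), sorry-free, from
`TruncatedFourierSynthesisL2` + Mathlib: a uniform-in-`κ` (`|κ| < ½`) quantitative `L²([−1,1])` synthesis of `2 sinh(κu)` by
`Σ_{|k|≤K₀} b_k e^{−iλ_k u}` for ANY `θH`-perturbation `λ` of the lattice `H·{−K₀,…,K₀}`, with cost + `c·Σ|b_k|²` below `2c/M`.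
Weaker than (and independent of) Kadec-¼ / Paley–Wiener perturbation theory (no Riesz-basis or frame property is claimed or
used: the period `T` and the tolerance `θ` are free).  Consumed by the rh-split cell's reduction
`Theorems/Splittings/BombieriTruncSynthesisScreening.lean` (input PA of card `SPLIT-x-wuc.md` §13, now discharged).  Placed under
`Theorems/Splittings/` by the lead's RULING #66 (2026-08-27T09:31:16Z: the lemma is the cell's, not print).
Provenance: cell rh-split, seat rh-split-x-wuc g7 (scratch `SplitXWucG7b.lean` d0583c86bc2d8ec7 §G7b Step 6, verbatim proof;
Mathlib-only replica `NearLatticeSynthesisG7.lean` 851a838689e7c9fb); cut (xiv-d) L2, `cut7/make_cut7.py` v2.  No instances, no notation,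
no named facts; nothing here bears on the truth of RH.
-/

set_option linter.dupNamespace false

noncomputable section

open scoped ComplexConjugate
open Set Filter Topology Complex MeasureTheory AddCircle

namespace Summit.RiemannHypothesis.RiemannHypothesis.Theorems.Splittings.NearLatticeFourierSynthesis

open Summit.RiemannHypothesis.RiemannHypothesis.Theorems.Splittings.TruncatedFourierSynthesisL2

/-! ### The near-lattice synthesis theorem (scratch §G7b Step 6) -/

/-- **Near-lattice synthesis of `2 sinh(κu)` on `[−1,1]` with an `ℓ²` amplitude budget.**  For every `M ≥ 1` and `c > 0`
there are a half-width `K₀`, a lattice step `H > 0` and a tolerance `0 < θ < ½` with `θH ≤ ½` such that for EVERY `|κ| < ½` and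
EVERY frequency list `λ` with `|λ_k − kH| ≤ θH` (`|k| ≤ K₀`) some amplitudes `b` achieve
`∫_{[−1,1]} |2 sinh(κu) − Σ_{|k|≤K₀} b_k e^{−iλ_k u}|² du + c·Σ_{|k|≤K₀} |b_k|² < 2c/M`.
Proof: `e = c/(4M)`; Taylor order `n₀` with `(1/4)^{n₀} < e/96`; period `T = 64 n₀² M`, `H = 2π/T`; Fourier data of the
monomial targets (`gm_synthesis`) truncated at a common `K₀`; `θ = min(1/4, e/(2(H²·#F+1)))`; `b_k = Σ_{m<n₀} w_m(κ) ĝ_m(−k)`,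
`w_m = (κ^m − (−κ)^m)/m!`; on `[−1,1]` the error is `A + B + C` (Taylor remainder / weighted partial-sum errors / lattice
perturbation), each piece `< e` after integration, total `< 4e = c/M`.  The statement is, token for token, the cell Prop
`…Theorems.Splittings.BombieriTruncSynthesisScreening.NearLatticeSynthesis` (input PA of card `SPLIT-x-wuc.md` §13). [folklore method; new packaging] -/
theorem nearLatticeSynthesis :
    ∀ (M : ℕ) (c : ℝ), 0 < M → 0 < c →
    ∃ (K₀ : ℕ) (H θ : ℝ), 0 < H ∧ 0 < θ ∧ θ < 1 / 2 ∧ θ * H ≤ 1 / 2 ∧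
      ∀ κ : ℝ, |κ| < 1 / 2 → ∀ lam : ℤ → ℝ,
        (∀ k ∈ Finset.Icc (-(K₀ : ℤ)) K₀, |lam k - k * H| ≤ θ * H) →
        ∃ b : ℤ → ℂ,
          (∫ u in Icc (-1 : ℝ) 1,
              ‖2 * (Real.sinh (κ * u) : ℂ) - ∑ k ∈ Finset.Icc (-(K₀ : ℤ)) K₀, b k * cexp (-(I * lam k * u))‖ ^ 2)
            + c * ∑ k ∈ Finset.Icc (-(K₀ : ℤ)) K₀, ‖b k‖ ^ 2 < 2 * c / M := by
  intro M c hM hc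
  have hMr : (1 : ℝ) ≤ M := by exact_mod_cast hM
  -- budget unit
  obtain ⟨e, he_def⟩ : ∃ e : ℝ, e = c / (4 * M) := ⟨_, rfl⟩
  have he : 0 < e := by rw [he_def]; positivity
  -- (1) Taylor order n₀
  obtain ⟨n₁, hn₁⟩ := exists_pow_lt_of_lt_one (show 0 < e / 96 by positivity) (show (1 / 4 : ℝ) < 1 by norm_num)
  obtain ⟨n₀, hn₀_def⟩ : ∃ n₀ : ℕ, n₀ = n₁ + 1 := ⟨_, rfl⟩
  have hn₀ : 0 < n₀ := by omega
  have hn₀r : (1 : ℝ) ≤ n₀ := by exact_mod_cast hn₀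
  have hq : (1 / 4 : ℝ) ^ n₀ < e / 96 :=
    lt_of_le_of_lt (by rw [hn₀_def]; exact pow_le_pow_of_le_one (by norm_num) (by norm_num) (Nat.le_succ n₁)) hn₁
  -- (2) period T and lattice step H
  obtain ⟨T, hT_def⟩ : ∃ T : ℝ, T = 64 * n₀ ^ 2 * M := ⟨_, rfl⟩
  have hT64 : 64 ≤ T := by
    have : (1 : ℝ) ≤ (n₀ : ℝ) ^ 2 := by nlinarith
    rw [hT_def]; nlinarith
  have hTpos : 0 < T := by linarith
  haveI hTfact : Fact (0 < T) := ⟨hTpos⟩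
  obtain ⟨H, hH_def⟩ : ∃ H : ℝ, H = 2 * Real.pi / T := ⟨_, rfl⟩
  have hHpos : 0 < H := by rw [hH_def]; positivity
  have hH1 : H ≤ 1 := by rw [hH_def, div_le_one hTpos]; linarith only [Real.pi_lt_four, hT64]
  -- (3) the targets: Fourier data and a common truncation K₀
  have hsyn := fun m : ℕ ↦ gm_synthesis (T := T) m
  choose cf hcfB hcfK using hsyn
  obtain ⟨η, hη_def⟩ : ∃ η : ℝ, η = e / (12 * n₀ ^ 2) := ⟨_, rfl⟩
  have hη : 0 < η := by rw [hη_def]; positivity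
  choose Km hKm using fun m : ℕ ↦ hcfK m η hη
  obtain ⟨K₀, hK₀_def⟩ : ∃ K₀ : ℕ, K₀ = (Finset.range n₀).sup Km := ⟨_, rfl⟩
  have hK₀ : ∀ m ∈ Finset.range n₀, Km m ≤ K₀ := fun m hm ↦ by rw [hK₀_def]; exact Finset.le_sup hm
  obtain ⟨F, hF_def⟩ : ∃ F : Finset ℤ, F = Finset.Icc (-(K₀ : ℤ)) K₀ := ⟨_, rfl⟩
  obtain ⟨NF, hNF_def⟩ : ∃ NF : ℝ, NF = F.card := ⟨_, rfl⟩
  have hNF0 : 0 ≤ NF := by rw [hNF_def]; positivity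
  -- (4) tolerance θ
  obtain ⟨G, hG_def⟩ : ∃ G : ℝ, G = H ^ 2 * NF + 1 := ⟨_, rfl⟩
  have hGpos : 0 < G := by rw [hG_def]; positivity
  obtain ⟨θ, hθ_def⟩ : ∃ θ : ℝ, θ = min (1 / 4) (e / (2 * G)) := ⟨_, rfl⟩
  have hθpos : 0 < θ := by rw [hθ_def]; exact lt_min (by norm_num) (by positivity)
  have hθ4 : θ ≤ 1 / 4 := by rw [hθ_def]; exact min_le_left _ _
  have hθG : θ * G ≤ e / 2 := by
    have : θ ≤ e / (2 * G) := by rw [hθ_def]; exact min_le_right _ _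
    rw [le_div_iff₀ (by positivity)] at this; linarith only [this]
  have hθH : θ * H ≤ 1 / 2 := (mul_le_mul hθ4 hH1 hHpos.le (by norm_num)).trans (by norm_num)
  refine ⟨K₀, H, θ, hHpos, hθpos, by linarith only [hθ4], hθH, ?_⟩
  rw [← hF_def]
  intro κ hκ lam hlam
  have hk1 : |κ| ≤ 1 := by linarith only [hκ, abs_nonneg κ]
  -- Taylor weights `w m = (κ^m - (-κ)^m)/m!` and amplitudes `b`
  obtain ⟨w, hw_def⟩ : ∃ w : ℕ → ℝ, w = fun m ↦ (κ ^ m - (-κ) ^ m) / m.factorial := ⟨_, rfl⟩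
  have hw2 : ∀ m, |w m| ≤ 2 := by
    intro m
    rw [hw_def]; dsimp only
    rw [abs_div, Nat.abs_cast]
    have hf1 : (1 : ℝ) ≤ m.factorial := by exact_mod_cast Nat.one_le_iff_ne_zero.mpr (Nat.factorial_ne_zero m)
    rw [div_le_iff₀ (by positivity)]
    have hp : |κ| ^ m ≤ 1 := pow_le_one₀ (abs_nonneg κ) hk1
    calc |κ ^ m - (-κ) ^ m| ≤ |κ ^ m| + |(-κ) ^ m| := abs_sub _ _
      _ = |κ| ^ m + |κ| ^ m := by rw [abs_pow, abs_pow, abs_neg]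
      _ ≤ 1 + 1 := add_le_add hp hp
      _ ≤ 2 * m.factorial := by linarith only [hf1]
  obtain ⟨b, hb_def⟩ : ∃ b : ℤ → ℂ, b = fun k ↦ ∑ m ∈ Finset.range n₀, (w m : ℂ) * cf m (-k) := ⟨_, rfl⟩
  refine ⟨b, ?_⟩
  -- (5) amplitude budget  Σ|b_k|² ≤ 1/(8M)
  have hwsq : ∑ m ∈ Finset.range n₀, ‖(w m : ℂ)‖ ^ 2 ≤ 4 * n₀ := by
    calc ∑ m ∈ Finset.range n₀, ‖(w m : ℂ)‖ ^ 2 ≤ ∑ m ∈ Finset.range n₀, (4 : ℝ) := by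
          refine Finset.sum_le_sum fun m _ ↦ ?_
          rw [Complex.norm_real, Real.norm_eq_abs]
          exact (pow_le_pow_left₀ (abs_nonneg _) (hw2 m) 2).trans (by norm_num)
      _ = 4 * n₀ := by simp [Finset.sum_const, Finset.card_range]; ring
  have hbsq : ∑ k ∈ F, ‖b k‖ ^ 2 ≤ 1 / (8 * M) := by
    calc ∑ k ∈ F, ‖b k‖ ^ 2
        ≤ ∑ k ∈ F, ((∑ m ∈ Finset.range n₀, ‖(w m : ℂ)‖ ^ 2) * ∑ m ∈ Finset.range n₀, ‖cf m (-k)‖ ^ 2) :=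
          Finset.sum_le_sum fun k _ ↦ by
            rw [hb_def]; exact norm_sum_mul_sq_le (Finset.range n₀) (fun m ↦ (w m : ℂ)) (fun m ↦ cf m (-k))
      _ ≤ ∑ k ∈ F, ((4 * n₀) * ∑ m ∈ Finset.range n₀, ‖cf m (-k)‖ ^ 2) :=
          Finset.sum_le_sum fun k _ ↦ mul_le_mul_of_nonneg_right hwsq (Finset.sum_nonneg fun _ _ ↦ by positivity)
      _ = 4 * n₀ * ∑ m ∈ Finset.range n₀, ∑ k ∈ F, ‖cf m (-k)‖ ^ 2 := by rw [← Finset.mul_sum, Finset.sum_comm]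
      _ = 4 * n₀ * ∑ m ∈ Finset.range n₀, ∑ n ∈ F, ‖cf m n‖ ^ 2 := by
          congr 1; refine Finset.sum_congr rfl fun m _ ↦ ?_
          rw [hF_def]
          exact (sum_Icc_neg K₀ (fun n ↦ ‖cf m n‖ ^ 2)).symm
      _ ≤ 4 * n₀ * ∑ m ∈ Finset.range n₀, (2 / T : ℝ) := by
          refine mul_le_mul_of_nonneg_left (Finset.sum_le_sum fun m _ ↦ ?_) (by positivity)
          rw [hF_def]; exact hcfB m K₀
      _ = 4 * n₀ * (n₀ * (2 / T)) := by simp [Finset.sum_const, Finset.card_range]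
      _ = 1 / (8 * M) := by rw [hT_def]; field_simp; ring
  -- (6) notation for the pieces
  obtain ⟨Sm, hSm_def⟩ : ∃ Sm : ℕ → ℝ → ℂ,
      Sm = fun m (u : ℝ) ↦ ∑ n ∈ F, cf m n * cexp (2 * Real.pi * I * n * u / T) := ⟨_, rfl⟩
  obtain ⟨err, herr_def⟩ : ∃ err : ℕ → ℝ → ℝ, err = fun m u ↦ ‖gm m u - Sm m u‖ ^ 2 := ⟨_, rfl⟩
  obtain ⟨A, hA_def⟩ : ∃ A : ℝ → ℂ,
      A = fun (u : ℝ) ↦ 2 * (Real.sinh (κ * u) : ℂ) - ∑ m ∈ Finset.range n₀, (w m : ℂ) * (u : ℂ) ^ m := ⟨_, rfl⟩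
  obtain ⟨B, hB_def⟩ : ∃ B : ℝ → ℂ,
      B = fun (u : ℝ) ↦ ∑ m ∈ Finset.range n₀, (w m : ℂ) * (gm m u - Sm m u) := ⟨_, rfl⟩
  obtain ⟨C, hC_def⟩ : ∃ C : ℝ → ℂ,
      C = fun (u : ℝ) ↦ ∑ k ∈ F, b k * (cexp (-(I * (k * H) * u)) - cexp (-(I * lam k * u))) := ⟨_, rfl⟩
  obtain ⟨α, hα_def⟩ : ∃ α : ℝ, α = 4 * (1 / 2 : ℝ) ^ n₀ := ⟨_, rfl⟩
  have hα2 : α ^ 2 = 16 * (1 / 4 : ℝ) ^ n₀ := by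
    rw [hα_def, mul_pow, ← pow_mul, mul_comm n₀ 2, pow_mul]; norm_num
  -- (6a) the lattice sum equals the weighted target partial sums
  have hlat : ∀ u : ℝ, ∑ k ∈ F, b k * cexp (-(I * (k * H) * u)) = ∑ m ∈ Finset.range n₀, (w m : ℂ) * Sm m u := by
    intro u
    have hexp : ∀ k : ℤ, cexp (-(I * (k * H) * u)) = cexp (2 * Real.pi * I * ((-k : ℤ) : ℂ) * u / T) := by
      intro k; congr 1; rw [hH_def]; push_cast; ring
    calc ∑ k ∈ F, b k * cexp (-(I * (k * H) * u))
        = ∑ k ∈ F, ∑ m ∈ Finset.range n₀, (w m : ℂ) * (cf m (-k) * cexp (2 * Real.pi * I * ((-k : ℤ) : ℂ) * u / T)) := by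
          refine Finset.sum_congr rfl fun k _ ↦ ?_
          rw [hb_def, hexp k]; dsimp only; rw [Finset.sum_mul]
          refine Finset.sum_congr rfl fun m _ ↦ ?_
          ring
      _ = ∑ m ∈ Finset.range n₀, ∑ k ∈ F, (w m : ℂ) * (cf m (-k) * cexp (2 * Real.pi * I * ((-k : ℤ) : ℂ) * u / T)) :=
          Finset.sum_comm
      _ = ∑ m ∈ Finset.range n₀, (w m : ℂ) * Sm m u := by
          refine Finset.sum_congr rfl fun m _ ↦ ?_
          rw [← Finset.mul_sum]
          congr 1
          rw [hSm_def, hF_def]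
          exact (sum_Icc_neg K₀ (fun n ↦ cf m n * cexp (2 * Real.pi * I * n * u / T))).symm
  -- (6b) decomposition on [-1,1]
  have hdec : ∀ u ∈ Icc (-1 : ℝ) 1,
      2 * (Real.sinh (κ * u) : ℂ) - ∑ k ∈ F, b k * cexp (-(I * lam k * u)) = A u + B u + C u := by
    intro u hu
    have hBu : B u = ∑ m ∈ Finset.range n₀, (w m : ℂ) * (u : ℂ) ^ m - ∑ m ∈ Finset.range n₀, (w m : ℂ) * Sm m u := by
      rw [hB_def]; dsimp only; rw [← Finset.sum_sub_distrib]
      refine Finset.sum_congr rfl fun m _ ↦ ?_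
      rw [gm_apply_of_mem hu]; ring
    have hCu : C u = ∑ k ∈ F, b k * cexp (-(I * (k * H) * u)) - ∑ k ∈ F, b k * cexp (-(I * lam k * u)) := by
      rw [hC_def]; dsimp only; rw [← Finset.sum_sub_distrib]
      refine Finset.sum_congr rfl fun k _ ↦ ?_; ring
    rw [hBu, hCu, hlat u, hA_def]; ring
  -- (6c) pointwise bounds on [-1,1]
  have hAu : ∀ u ∈ Icc (-1 : ℝ) 1, ‖A u‖ ≤ α := by
    intro u hu
    have hu1 : |u| ≤ 1 := abs_le.2 ⟨hu.1, hu.2⟩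
    have hxu : |κ * u| ≤ 1 / 2 := by
      rw [abs_mul]
      exact (mul_le_mul hκ.le hu1 (abs_nonneg u) (by norm_num)).trans (by norm_num)
    have ht := two_sinh_taylor hn₀ hxu
    have hcast : A u = ((2 * Real.sinh (κ * u)
        - ∑ m ∈ Finset.range n₀, ((κ * u) ^ m - (-(κ * u)) ^ m) / m.factorial : ℝ) : ℂ) := by
      rw [hA_def, hw_def]; push_cast
      congr 1
      refine Finset.sum_congr rfl fun m _ ↦ ?_; ring
    rw [hcast, Complex.norm_real, Real.norm_eq_abs, hα_def]
    exact ht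
  have hBu : ∀ u : ℝ, ‖B u‖ ^ 2 ≤ 4 * n₀ * ∑ m ∈ Finset.range n₀, err m u := by
    intro u
    calc ‖B u‖ ^ 2 ≤ (∑ m ∈ Finset.range n₀, ‖(w m : ℂ)‖ ^ 2) * ∑ m ∈ Finset.range n₀, ‖gm m u - Sm m u‖ ^ 2 := by
          rw [hB_def]
          exact norm_sum_mul_sq_le (Finset.range n₀) (fun m ↦ (w m : ℂ)) (fun m ↦ gm m u - Sm m u)
      _ ≤ 4 * n₀ * ∑ m ∈ Finset.range n₀, err m u := by
          rw [herr_def]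
          exact mul_le_mul_of_nonneg_right hwsq (Finset.sum_nonneg fun _ _ ↦ by positivity)
  have hCu : ∀ u ∈ Icc (-1 : ℝ) 1, ‖C u‖ ^ 2 ≤ 1 / (8 * M) * (NF * (θ * H) ^ 2) := by
    intro u hu
    have hu1 : |u| ≤ 1 := abs_le.2 ⟨hu.1, hu.2⟩
    have hterm : ∀ k ∈ F, ‖cexp (-(I * (k * H) * u)) - cexp (-(I * lam k * u))‖ ≤ θ * H := by
      intro k hk
      calc ‖cexp (-(I * (k * H) * u)) - cexp (-(I * lam k * u))‖
          ≤ |k * H - lam k| * |u| := by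
            have := norm_cexp_sub_cexp_le (k * H) (lam k) u
            push_cast at this
            exact this
        _ ≤ θ * H * 1 := by
            have h1 : |k * H - lam k| ≤ θ * H := by rw [abs_sub_comm]; exact hlam k hk
            exact mul_le_mul h1 hu1 (abs_nonneg u) (mul_nonneg hθpos.le hHpos.le)
        _ = θ * H := mul_one _
    calc ‖C u‖ ^ 2 ≤ (∑ k ∈ F, ‖b k‖ ^ 2) * ∑ k ∈ F, ‖cexp (-(I * (k * H) * u)) - cexp (-(I * lam k * u))‖ ^ 2 := by
          rw [hC_def]
          exact norm_sum_mul_sq_le F b (fun k ↦ cexp (-(I * (k * H) * u)) - cexp (-(I * lam k * u)))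
      _ ≤ (∑ k ∈ F, ‖b k‖ ^ 2) * ∑ k ∈ F, (θ * H) ^ 2 := by
          refine mul_le_mul_of_nonneg_left (Finset.sum_le_sum fun k hk ↦ ?_) (Finset.sum_nonneg fun _ _ ↦ by positivity)
          exact pow_le_pow_left₀ (norm_nonneg _) (hterm k hk) 2
      _ ≤ 1 / (8 * M) * ∑ k ∈ F, (θ * H) ^ 2 :=
          mul_le_mul_of_nonneg_right hbsq (Finset.sum_nonneg fun _ _ ↦ by positivity)
      _ = 1 / (8 * M) * (NF * (θ * H) ^ 2) := by rw [Finset.sum_const, nsmul_eq_mul, hNF_def]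
  -- (6d) the pointwise majorant
  obtain ⟨Cst, hCst_def⟩ : ∃ Cst : ℝ, Cst = 3 * α ^ 2 + 3 * (1 / (8 * M) * (NF * (θ * H) ^ 2)) := ⟨_, rfl⟩
  have hmaj : ∀ u ∈ Icc (-1 : ℝ) 1,
      ‖2 * (Real.sinh (κ * u) : ℂ) - ∑ k ∈ F, b k * cexp (-(I * lam k * u))‖ ^ 2
        ≤ Cst + 12 * n₀ * ∑ m ∈ Finset.range n₀, err m u := by
    intro u hu
    rw [hdec u hu]
    have hA' : ‖A u‖ ^ 2 ≤ α ^ 2 := pow_le_pow_left₀ (norm_nonneg _) (hAu u hu) 2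
    calc ‖A u + B u + C u‖ ^ 2 ≤ 3 * (‖A u‖ ^ 2 + ‖B u‖ ^ 2 + ‖C u‖ ^ 2) := norm_add_three_sq _ _ _
      _ ≤ 3 * (α ^ 2 + 4 * n₀ * ∑ m ∈ Finset.range n₀, err m u + 1 / (8 * M) * (NF * (θ * H) ^ 2)) := by
          have := hBu u; have := hCu u hu
          gcongr
      _ = Cst + 12 * n₀ * ∑ m ∈ Finset.range n₀, err m u := by rw [hCst_def]; ring
  -- (7) integrate over [-1,1]
  have hsub : Icc (-1 : ℝ) 1 ⊆ Ioc (-T / 2) (-T / 2 + T) := by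
    intro u hu
    exact ⟨by linarith only [hu.1, hT64], by linarith only [hu.2, hT64]⟩
  have herr_int' : ∀ m, IntegrableOn (err m) (Ioc (-T / 2) (-T / 2 + T)) := by
    intro m; rw [herr_def, hSm_def]; exact integrableOn_gm_err m F (cf m) T (-T / 2) (-T / 2 + T)
  have herr_int : ∀ m, IntegrableOn (err m) (Icc (-1 : ℝ) 1) := fun m ↦ (herr_int' m).mono_set hsub
  have herr_nn : ∀ m u, 0 ≤ err m u := by intro m u; rw [herr_def]; positivity
  have herr_le : ∀ m ∈ Finset.range n₀, ∫ u in Icc (-1 : ℝ) 1, err m u < η := by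
    intro m hm
    calc ∫ u in Icc (-1 : ℝ) 1, err m u ≤ ∫ u in Ioc (-T / 2) (-T / 2 + T), err m u :=
          setIntegral_mono_set (herr_int' m) (Eventually.of_forall (herr_nn m)) (Eventually.of_forall hsub)
      _ < η := by
          have := hKm m K₀ (hK₀ m hm)
          rw [← hF_def] at this
          rw [herr_def, hSm_def]
          exact this
  have hsum_int : Integrable (fun u ↦ ∑ m ∈ Finset.range n₀, err m u) (volume.restrict (Icc (-1 : ℝ) 1)) :=
    integrable_finsetSum (Finset.range n₀) (fun m _ ↦ herr_int m)
  have hconst_int : Integrable (fun _ : ℝ ↦ Cst) (volume.restrict (Icc (-1 : ℝ) 1)) := integrable_const Cst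
  have hU_int : Integrable (fun u ↦ Cst + 12 * n₀ * ∑ m ∈ Finset.range n₀, err m u)
      (volume.restrict (Icc (-1 : ℝ) 1)) := hconst_int.add (hsum_int.const_mul _)
  have hcost : ∫ u in Icc (-1 : ℝ) 1, ‖2 * (Real.sinh (κ * u) : ℂ) - ∑ k ∈ F, b k * cexp (-(I * lam k * u))‖ ^ 2
      ≤ ∫ u in Icc (-1 : ℝ) 1, (Cst + 12 * n₀ * ∑ m ∈ Finset.range n₀, err m u) := by
    apply integral_mono_of_nonneg
    · exact Eventually.of_forall fun u ↦ by positivity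
    · exact hU_int
    · exact (ae_restrict_iff' measurableSet_Icc).2 (Eventually.of_forall hmaj)
  have hrhs : ∫ u in Icc (-1 : ℝ) 1, (Cst + 12 * n₀ * ∑ m ∈ Finset.range n₀, err m u)
      = 2 * Cst + 12 * n₀ * ∑ m ∈ Finset.range n₀, ∫ u in Icc (-1 : ℝ) 1, err m u := by
    rw [integral_add hconst_int (hsum_int.const_mul _), integral_const_mul,
      integral_finsetSum _ (fun m _ ↦ herr_int m), setIntegral_const,
      Real.volume_real_Icc_of_le (by norm_num), smul_eq_mul]
    norm_num
  have hsum_lt : ∑ m ∈ Finset.range n₀, ∫ u in Icc (-1 : ℝ) 1, err m u < n₀ * η := by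
    calc ∑ m ∈ Finset.range n₀, ∫ u in Icc (-1 : ℝ) 1, err m u < ∑ m ∈ Finset.range n₀, η :=
          Finset.sum_lt_sum_of_nonempty (Finset.nonempty_range_iff.2 hn₀.ne') herr_le
      _ = n₀ * η := by simp [Finset.sum_const, Finset.card_range]
  -- (8) bookkeeping
  have h1 : 6 * α ^ 2 < e := by rw [hα2]; linarith only [hq]
  have h2 : NF * (θ * H) ^ 2 ≤ e / 8 := by
    have e1 : NF * (θ * H) ^ 2 = θ * (θ * (G - 1)) := by rw [hG_def]; ring
    rw [e1]
    have e2 : θ * (G - 1) ≤ e / 2 := by rw [mul_sub, mul_one]; linarith only [hθG, hθpos.le]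
    calc θ * (θ * (G - 1)) ≤ θ * (e / 2) := mul_le_mul_of_nonneg_left e2 hθpos.le
      _ ≤ 1 / 4 * (e / 2) := mul_le_mul_of_nonneg_right hθ4 (by positivity)
      _ = e / 8 := by ring
  have hM8 : 1 / (8 * (M : ℝ)) ≤ 1 / 8 := by
    rw [div_le_div_iff_of_pos_left (by norm_num) (by positivity) (by norm_num)]; linarith only [hMr]
  have h3 : 6 * (1 / (8 * M) * (NF * (θ * H) ^ 2)) < e := by
    have hX0 : 0 ≤ NF * (θ * H) ^ 2 := by positivity
    have : 1 / (8 * M) * (NF * (θ * H) ^ 2) ≤ 1 / 8 * (e / 8) :=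
      mul_le_mul hM8 h2 hX0 (by norm_num)
    linarith only [this, he]
  have h4 : 12 * (n₀ : ℝ) * ∑ m ∈ Finset.range n₀, ∫ u in Icc (-1 : ℝ) 1, err m u < e := by
    have e1 : 12 * (n₀ : ℝ) * (n₀ * η) = e := by rw [hη_def]; field_simp
    have : 12 * (n₀ : ℝ) * ∑ m ∈ Finset.range n₀, ∫ u in Icc (-1 : ℝ) 1, err m u < 12 * n₀ * (n₀ * η) :=
      mul_lt_mul_of_pos_left hsum_lt (by positivity)
    linarith only [this, e1]
  have h5 : c * ∑ k ∈ F, ‖b k‖ ^ 2 ≤ e / 2 := by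
    have e1 : c * (1 / (8 * M)) = e / 2 := by rw [he_def]; field_simp; ring
    have := mul_le_mul_of_nonneg_left hbsq hc.le
    linarith only [this, e1]
  have h6 : 4 * e = c / M := by rw [he_def]; field_simp
  have h7 : c / M < 2 * c / M := by
    have : 0 < c / M := by positivity
    have e1 : 2 * c / (M : ℝ) = 2 * (c / M) := by ring
    linarith only [this, e1]
  have h2Cst : 2 * Cst = 6 * α ^ 2 + 6 * (1 / (8 * M) * (NF * (θ * H) ^ 2)) := by rw [hCst_def]; ring
  calc (∫ u in Icc (-1 : ℝ) 1, ‖2 * (Real.sinh (κ * u) : ℂ) - ∑ k ∈ F, b k * cexp (-(I * lam k * u))‖ ^ 2)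
        + c * ∑ k ∈ F, ‖b k‖ ^ 2
      ≤ (2 * Cst + 12 * n₀ * ∑ m ∈ Finset.range n₀, ∫ u in Icc (-1 : ℝ) 1, err m u) + e / 2 := by
        rw [← hrhs]; exact add_le_add hcost h5
    _ < 2 * c / M := by linarith only [h1, h3, h4, h6, h7, h2Cst, he]

end Summit.RiemannHypothesis.RiemannHypothesis.Theorems.Splittings.NearLatticeFourierSynthesis
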